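import Literature.MathematicalPhysics.QuantumFieldTheory.Balaban1983to89.Node00.OpsYNablaBridge
import Literature.MathematicalPhysics.QuantumFieldTheory.Balaban1983to89.Node00.OpsYBondCoords
import Literature.MathematicalPhysics.QuantumFieldTheory.Balaban1983to89.B9Eq376POneLetters

/-!
# Balaban [B9], (3.3) p. 390 and (3.8) p. 392 — NODE 00's covariant gradient `D_U` and divergence `D*_U` ARE r06's letters `gradLin` ∕ `divLin` IN BOND
# COORDINATES: `bondFunCoordsY_gradY`, `divY_bondFunCoordsY_symm` (DESIGN POINT 2a of the pub-ymgap N06 G-side plan — the first brick of the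
# identification of NODE 00's `Δ_a(U)` with r06's concrete `deltaA` word)

T. Bałaban, *Propagators for lattice gauge theories in a background field*, Commun. Math. Phys. **99** (1985) 389–434
[`Balaban1985BackgroundPropagators`, "B9"].

statement-level skeleton of published theorems with citation tags; proofs where landed; nothing here is a claim about the
Yang–Mills mass gap

THE PRINTED LOCI.  (3.3) p. 390: *«(D_U λ)(⟨x, x′⟩) = η⁻¹(R(U(x, x′))λ(x′) − λ(x))»*; (3.8) p. 392: *«(D*A)(x) = Σ_μ η⁻¹(R(U(x, x−ηe_μ))A(x−ηe_μ, x) −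
A(x, x+ηe_μ))»*.

WHY THIS FILE (pub-ymgap N06 row 13, G side, seat dag-n06-c gen 13; G-SIDE-PLAN v2, Route L, file L-2).  The letters route to the Hölder ∕ `L²` members of
`G(U′U)` (r06's `thm34_G_…_uniform_blk` engines through the V4 frames `B9SectBGFrameV4`) needs NODE 00's `Δ_a(V) = Δ(V) + D_V R(V) D*_V + Q*(V)aQ(V)`
(`Node00.deltaAY`) identified with r06's concrete word `deltaA (conj b (lapDDLetter …)) (conj b (dPrimeLetter …)) (conjHom b (gradLin …) ∘ (1 − …) ∘
conjHom b (divLin …)) …` on the real bond carrier.  THIS FILE does the two FIRST-ORDER letters, exactly and for EVERY configuration `U` and EVERY algebra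
`𝔸`: in the bond coordinates of node00-def-Y's `Node00/OpsYBondCoords` (`bondFunCoordsY : (FBondY → 𝔸) ≃ (Fin (d+1) × SiteY → 𝔸)`, `b ↦ (b.dir, boxEquiv
b.src)`), NODE 00's `gradY U` IS r06's `gradLin (shiftY) c_f (UboxY U)` (`B9Eq376POneLetters.gradLin`, with `covD` of `B9Eq39Adjoint`) and NODE 00's `divY U`
IS r06's `divLin (shiftY) c_f (UboxY U)` — same constant `c_f = i.cf` on both sides (r06's frames instantiate the constant at `((geo i).eta : ℂ)⁻¹ = |c_f|`;
the sign of `c_f` is the instance's bookkeeping, not this file's).  Proofs: def-Y's pointwise letters `Node00.OpsYNablaBridge.gradY_apply_eq_cdS` ∕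
`divY_apply_eq_sum_cdsS` (`cdS`, `cdsS` ARE `covD`, `covDstar` at `T := shiftY`, `V := UboxY U`, by `rfl`).

HONEST SCOPE.  Two exact finite-dimensional operator identities between DEFINED objects of two cell lineages; no estimate; nothing of [B9] asserted;
count-neutral; N06 NOT discharged; nothing continuum ∕ OS ∕ mass-gap ∕ Clay.  No `sorry`, no `axiom`, no `def`, no `instance`.  `--supports
stmt-QuantumFields-27364`.

RELATED IN THE TREE, NOT DUPLICATED: `Node00.OpsYNablaBridge` (def-Y: `gradY`∕`divY` versus def-Y's OWN site letters `cdS`∕`cdsS` — USED), `Node00.OpsYBondCoords`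
(the coordinates — USED), `B9Eq376POneLetters` (r06's letters — USED), `B9Eq360DeltaPrimeAY` (the `G′`-side twin: NODE 00's site Laplacian versus r06's (3.23)).
-/

noncomputable section

namespace Literature.MathematicalPhysics.QuantumFieldTheory.Balaban1983to89.B9SectBGWordGradDivY

open Literature.MathematicalPhysics.QuantumFieldTheory.Balaban1983to89
open Literature.MathematicalPhysics.QuantumFieldTheory.Balaban1983to89.B6KLevelCensusIndexV1 (KIdx)
open Literature.MathematicalPhysics.QuantumFieldTheory.Balaban1983to89.B9Eq39Adjoint (R covD covDstar)
open Literature.MathematicalPhysics.QuantumFieldTheory.Balaban1983to89.B9Eq376POneLetters (gradLin divLin gradLin_apply divLin_apply)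
open Literature.MathematicalPhysics.QuantumFieldTheory.Balaban1983to89.Node00 (SiteY FBondY CfgY UboxY shiftY gradY divY cdS cdsS bondCoordsY bondFunCoordsY
  bondFunCoordsY_apply bondFunCoordsY_symm_apply bondCoordsY_symm_mk bondCoordsY_apply bondFunCoordsY_apply_bondCoordsY)
open Literature.MathematicalPhysics.QuantumFieldTheory.Balaban1983to89.Node00.OpsYNablaBridge (chartY chartY_eq cdS_apply cdsS_apply
  gradY_apply_eq_cdS divY_apply_eq_sum_cdsS bondCompY bondCompY_apply)

variable {𝔸 : Type} [NormedRing 𝔸] [NormedAlgebra ℂ 𝔸] [CompleteSpace 𝔸]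
variable {d ℓ : ℕ} {hd : 1 ≤ d + 1} {hL : Odd (ℓ + 1) ∧ 1 < ℓ + 1} {b₀ b₁ : ℝ}
variable (i : KIdx d ℓ hd hL b₀ b₁)

/-- def-Y's site derivative `cdS` IS r06's `covD` at the box shifts and the charted background (`rfl`). [cite: Balaban1985BackgroundPropagators, (3.3) p.390, bookkeeping] -/
theorem cdS_eq_covD (U : CfgY 𝔸 i) (μ : Fin (d + 1)) (Φ : SiteY i → 𝔸) (z : SiteY i) :
    cdS i U μ Φ z = covD (shiftY i) (UboxY i U) μ Φ z := rfl

/-- def-Y's adjoint site derivative `cdsS` IS r06's `covDstar` at the box shifts and the charted background (`rfl`). [cite: Balaban1985BackgroundPropagators, (3.8) p.392, bookkeeping] -/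
theorem cdsS_eq_covDstar (U : CfgY 𝔸 i) (μ : Fin (d + 1)) (Φ : SiteY i → 𝔸) (z : SiteY i) :
    cdsS i U μ Φ z = covDstar (shiftY i) (UboxY i U) μ Φ z := rfl

/-- ★ **(3.3) — NODE 00's `D_U` IS r06's `gradLin` IN BOND COORDINATES**: for every `U`, `λ`: `bondFunCoordsY (gradY U λ) = gradLin (shiftY) c_f (UboxY U) λ`,
i.e. `(D_Uλ)(⟨chart⁻¹z, μ⟩) = c_f·(R(U_μ(z))λ(z + e_μ) − λ(z))`. [cite: Balaban1985BackgroundPropagators, (3.3) p.390] -/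
theorem bondFunCoordsY_gradY (U : CfgY 𝔸 i) (Φ : SiteY i → 𝔸) :
    bondFunCoordsY i (gradY i U Φ) = gradLin (shiftY i) ((i.cf : ℝ) : ℂ) (UboxY i U) Φ := by
  funext p
  obtain ⟨μ, z⟩ := p
  rw [bondFunCoordsY_apply, gradLin_apply, gradY_apply_eq_cdS, bondCoordsY_symm_mk]
  show ((i.cf : ℝ) : ℂ) • cdS i U μ Φ (chartY i ((chartY i).symm z)) = _
  rw [Equiv.apply_symm_apply]
  rfl

/-- the same at a bond: `(D_Uλ)(b) = (gradLin (shiftY) c_f (UboxY U) λ)(b.dir, chart b.src)`. [cite: Balaban1985BackgroundPropagators, (3.3) p.390] -/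
theorem gradY_apply_eq_gradLin (U : CfgY 𝔸 i) (Φ : SiteY i → 𝔸) (b : FBondY i) :
    gradY i U Φ b = gradLin (shiftY i) ((i.cf : ℝ) : ℂ) (UboxY i U) Φ (bondCoordsY i b) := by
  rw [← bondFunCoordsY_gradY, bondFunCoordsY_apply_bondCoordsY]

/-- ★ **(3.8) — NODE 00's `D*_U` IS r06's `divLin` IN BOND COORDINATES**: for every `U` and every bond function in coordinates `F`:
`divY U (bondFunCoordsY⁻¹ F) = divLin (shiftY) c_f (UboxY U) F`, i.e. `(D*_UA)(z) = c_f·Σ_μ (R(U_μ(z−e_μ))⁻¹A_μ(z−e_μ) − A_μ(z))`.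
[cite: Balaban1985BackgroundPropagators, (3.8) p.392] -/
theorem divY_bondFunCoordsY_symm (U : CfgY 𝔸 i) (F : Fin (d + 1) × SiteY i → 𝔸) :
    divY i U ((bondFunCoordsY i).symm F) = divLin (shiftY i) ((i.cf : ℝ) : ℂ) (UboxY i U) F := by
  funext z
  rw [divY_apply_eq_sum_cdsS, divLin_apply]
  refine congrArg _ (Finset.sum_congr rfl fun μ _ => ?_)
  have hcomp : bondCompY i μ ((bondFunCoordsY i).symm F) = fun w => F (μ, w) := by
    funext w
    rw [bondCompY_apply, bondFunCoordsY_symm_apply, bondCoordsY_apply]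
    show F (μ, chartY i ((chartY i).symm w)) = F (μ, w)
    rw [Equiv.apply_symm_apply]
  rw [hcomp]
  rfl

/-- the same for a bond function `A`: `(D*_UA)(z) = (divLin (shiftY) c_f (UboxY U) (bondFunCoordsY A))(z)`. [cite: Balaban1985BackgroundPropagators, (3.8) p.392] -/
theorem divY_apply_eq_divLin (U : CfgY 𝔸 i) (A : FBondY i → 𝔸) (z : SiteY i) :
    divY i U A z = divLin (shiftY i) ((i.cf : ℝ) : ℂ) (UboxY i U) (bondFunCoordsY i A) z := by
  rw [← divY_bondFunCoordsY_symm, LinearEquiv.symm_apply_apply]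

end Literature.MathematicalPhysics.QuantumFieldTheory.Balaban1983to89.B9SectBGWordGradDivY

end
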